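import Literature.AnabelianGeometry.SemiGraphs.SurfaceTypeLoopModels
import Literature.AnabelianGeometry.SemiGraphs.ProSigmaCompletionExtend
import Literature.AnabelianGeometry.SemiGraphs.ProSigmaCompletionInjective
import Literature.AnabelianGeometry.SemiGraphs.ProSigmaCompletionWreath
import Literature.GroupTheory.CombinatorialGroupTheory.PuncturedSurfaceGroupFreeBasis
import Mathlib.Topology.Instances.ZMod
import HarnessLib

/-!
# Cusp classes are NOT characteristic in a pro-`Σ` surface group: a continuous automorphism of a
# pro-`Σ` completion of `Γ_{g,r}` moving a cusp inertia group off every cuspidal conjugacy class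

Mochizuki, *Semi-graphs of anabelioids* [SemiAnbd] Example 2.10 p. 31 (pro-`Σ` completions
`ι : Γ_{g,r} → Π` of punctured surface groups, cusp inertia subgroups `closure ι⟨c_j⟩`); *Topics in
Absolute Anabelian Geometry I* [AbsTopI] Lemma 4.5 (v) p. 55 (the cuspidal decomposition groups of
the ARITHMETIC fundamental group `Π ↠ G_k` of a hyperbolic orbicurve are characteristic — "a
group-theoretic characterization of the decomposition groups of cusps in `Π`" — which print derives
from (iii), the WEIGHTS of the Galois action).

PROOF-ONLY file (abc-iut cell, FACT-LIST row F-0206 `CuspidalAlgorithm.RecoversCusps`, seat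
abc-iut-f-060; tightness of [AbsTopI] Lemma 4.5 (v)).  The geometric half of the statement is FALSE
on its own: for every hyperbolic type `(g, r)` with `r ≥ 2` and every pro-`Σ` completion
`ι : Γ_{g,r} → Π` (`Π` profinite, `Σ` containing a prime), there is a continuous automorphism
`ê : Π ≅ Π` such that `ê(closure ι⟨c₁⟩)` is NOT a `Π`-conjugate of ANY cusp inertia group
`closure ι⟨c_y⟩` (`exists_continuousMulEquiv_map_cuspInertia_not_conj`).  Construction: `Γ_{g,r}`
(`r = r' + 2`) is free on `aᵢ, bᵢ, c₁, …, c_{r−1}` (`PuncturedSurfaceGroup.freeEquiv`); the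
TRANSVECTION `c₁ ↦ c₁·s²`, every other free generator fixed (`s` a second free generator: `c₂` if
`r ≥ 3`, else `a₁`), is an automorphism `β` of `Γ_{g,r}`; `ι ∘ β` is again a pro-`Σ` completion
(`IsProSigmaCompletion.comp_mulEquiv`), so `β` extends to `ê` (`exists_continuousMulEquiv`).
Detection: the character `Γ_{g,r} → (ℤ/p²)²`, `c₁ ↦ (1,0)`, `s ↦ (0,1)`, other free generators `↦ 0`
(`p ∈ Σ`), extends continuously to `Π` (`exists_continuous_extend_top`); it maps every cusp inertia
group into the cyclic group generated by the image of `c_y` ∈ {`(1,0)`, `(0,1)`, `0`, `−(1,ε)`}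
(`ε ∈ {0,1}`), none of which contains the image `(1,2)` of `β(c₁)`; conjugation is invisible in the
abelian target.

HONEST FRAMING: elementary profinite group theory about surface groups; it shows that the
arithmetic input of [AbsTopI] Lemma 4.5 (iii)/(v) (weights) is NECESSARY — at a split extension
`G × Δ` the cusps of `Δ` cannot be recovered (see `AbsTopIChainsCuspidalSplitSurfaceModel.lean`);
nothing here bears on [IUTchIII] Cor 3.12; no abc claim.
-/

noncomputable section

namespace Literature.AnabelianGeometry.SemiGraphs.SemiGraphOfAnabelioids.IsProSigmaCompletion

open scoped Pointwise
open Literature.GroupTheory.CombinatorialGroupTheory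
open Literature.AnabelianGeometry.Anabelioids (IsSigmaInteger)

universe u

variable {Sigma : Set ℕ} {g r : ℕ} {Q : Type u} [Group Q] [TopologicalSpace Q] [IsTopologicalGroup Q]
  [CompactSpace Q] [TotallyDisconnectedSpace Q]

/-- **A pro-`Σ` completion of a hyperbolic `Γ_{g,r}` with `r ≥ 2` carries a continuous automorphism
moving the closed inertia group of the cusp `c₁` (index `1`) off EVERY cuspidal conjugacy class**:
`ê(closure ι⟨c₁⟩) ≠ q · closure ι⟨c_y⟩ · q⁻¹` for all cusps `y` and all `q ∈ Π`.  (`ê` extends the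
transvection `c₁ ↦ c₁ s²` of the free group `Γ_{g,r}`; a `(ℤ/p²)²`-valued character separates.)
Hence the conjugacy classes of cusp inertia subgroups of a pro-`Σ` surface group are NOT preserved by
its continuous automorphisms: the "group-theoretic characterization of the decomposition groups of
cusps" of [AbsTopI] Lemma 4.5 (v) needs the arithmetic quotient `Π ↠ G_k` (weights, Lemma 4.5 (iii)).
[cite: MochizukiAbsTopI2012, Lemma 4.5 (v) p.55] [cite: MochizukiSemiAnbd2006, Ex. 2.10 p.31] -/
theorem exists_continuousMulEquiv_map_cuspInertia_not_conj (hne : Sigma.Nonempty)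
    (hprime : ∀ p ∈ Sigma, p.Prime) (hgr : PuncturedSurfaceGroup.IsHyperbolicType g (r + 2))
    (ι : PuncturedSurfaceGroup g (r + 2) →* Q) (hι : IsProSigmaCompletion Sigma ι) :
    ∃ e : Q ≃ₜ* Q, ∀ (y : Fin (r + 2)) (q : Q),
      ((PuncturedSurfaceGroup.cuspInertia (g := g) (1 : Fin (r + 2))).map ι).topologicalClosure.map
          e.toMulEquiv.toMonoidHom ≠
        ConjAct.toConjAct q •
          ((PuncturedSurfaceGroup.cuspInertia (g := g) y).map ι).topologicalClosure := by
  classical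
  obtain ⟨p, hpS⟩ := hne
  have hp : p.Prime := hprime p hpS
  -- the letters of the free basis of `Γ_{g,r+2}`: `aᵢ, bᵢ` (`inl`) and `c₁, …, c_{r+1}` (`inr 0, …, inr r`)
  let L : Type := (Fin g × Bool) ⊕ Fin (r + 1)
  let M : Type := Multiplicative (ZMod (p ^ 2) × ZMod (p ^ 2))
  haveI : NeZero (p ^ 2) := ⟨pow_ne_zero 2 hp.ne_zero⟩
  haveI : Finite M := inferInstanceAs (Finite (Multiplicative (ZMod (p ^ 2) × ZMod (p ^ 2))))
  letI : TopologicalSpace M :=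
    inferInstanceAs (TopologicalSpace (Multiplicative (ZMod (p ^ 2) × ZMod (p ^ 2))))
  haveI : DiscreteTopology M :=
    inferInstanceAs (DiscreteTopology (Multiplicative (ZMod (p ^ 2) × ZMod (p ^ 2))))
  -- a second free generator `s ≠ c₁` and the value `ε` with `∑_j w(c_{j+1}) = (1, ε)`
  obtain ⟨s, hs0, ε, hε, hsval⟩ : ∃ s : L, s ≠ Sum.inr 0 ∧ ∃ ε : ZMod (p ^ 2), (ε = 0 ∨ ε = 1) ∧
      (∏ j : Fin (r + 1),
        (if (Sum.inr j : L) = Sum.inr 0 then Multiplicative.ofAdd ((1 : ZMod (p ^ 2)), (0 : ZMod (p ^ 2)))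
          else if (Sum.inr j : L) = s then Multiplicative.ofAdd (0, 1) else (1 : M))) =
        Multiplicative.ofAdd (1, ε) := by
    rcases Nat.eq_zero_or_pos r with hr | hr
    · -- two cusps: `g ≥ 1`, take `s = a₁`
      subst hr
      have hg : 0 < g := by unfold PuncturedSurfaceGroup.IsHyperbolicType at hgr; omega
      refine ⟨Sum.inl (⟨0, hg⟩, false), by simp, 0, Or.inl rfl, ?_⟩
      rw [Fin.prod_univ_one]
      simp
    · -- at least three cusps: take `s = c₂`
      obtain ⟨r', rfl⟩ : ∃ r', r = r' + 1 := ⟨r - 1, by omega⟩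
      have hne10 : (Sum.inr (Fin.succ 0) : L) ≠ Sum.inr 0 := fun h =>
        Fin.succ_ne_zero 0 (Sum.inr_injective h)
      refine ⟨Sum.inr (Fin.succ 0), hne10, 1, Or.inr rfl, ?_⟩
      rw [Fin.prod_univ_succ, Fin.prod_univ_succ, Finset.prod_eq_one]
      · rw [if_pos rfl, if_neg hne10, if_pos rfl, mul_one, ← ofAdd_add, Prod.mk_add_mk, add_zero,
          zero_add]
      · intro j _
        have h1 : (Sum.inr (Fin.succ (Fin.succ j)) : L) ≠ Sum.inr 0 := fun h =>
          Fin.succ_ne_zero _ (Sum.inr_injective h)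
        have h2 : (Sum.inr (Fin.succ (Fin.succ j)) : L) ≠ Sum.inr (Fin.succ 0) := fun h =>
          Fin.succ_ne_zero _ (Fin.succ_inj.mp (Sum.inr_injective h))
        rw [if_neg h1, if_neg h2]
  -- the detection weights on letters and the character `φ` of the free group
  let w : L → M := fun t =>
    if t = Sum.inr 0 then Multiplicative.ofAdd (1, 0)
      else if t = s then Multiplicative.ofAdd (0, 1) else 1
  have hw0 : w (Sum.inr 0) = Multiplicative.ofAdd (1, 0) := by simp [w]
  have hws : w s = Multiplicative.ofAdd (0, 1) := by simp [w, hs0]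
  let φ : FreeGroup L →* M := FreeGroup.lift w
  have hφ : ∀ t, φ (FreeGroup.of t) = w t := fun t => FreeGroup.lift_apply_of
  -- the transvection `θ : x₀ ↦ x₀ s², t ↦ t` of the free group, an automorphism
  let θto : FreeGroup L →* FreeGroup L := FreeGroup.lift fun t =>
    if t = Sum.inr 0 then FreeGroup.of (Sum.inr 0) * FreeGroup.of s ^ 2 else FreeGroup.of t
  let θinv : FreeGroup L →* FreeGroup L := FreeGroup.lift fun t =>
    if t = Sum.inr 0 then FreeGroup.of (Sum.inr 0) * (FreeGroup.of s ^ 2)⁻¹ else FreeGroup.of t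
  have hθto0 : θto (FreeGroup.of (Sum.inr 0)) = FreeGroup.of (Sum.inr 0) * FreeGroup.of s ^ 2 := by
    simp [θto]
  have hθtos : θto (FreeGroup.of s) = FreeGroup.of s := by simp [θto, hs0]
  have hθinv0 : θinv (FreeGroup.of (Sum.inr 0)) =
      FreeGroup.of (Sum.inr 0) * (FreeGroup.of s ^ 2)⁻¹ := by simp [θinv]
  have hθinvs : θinv (FreeGroup.of s) = FreeGroup.of s := by simp [θinv, hs0]
  have hθ1 : θinv.comp θto = MonoidHom.id _ := by
    ext t
    simp only [MonoidHom.comp_apply, MonoidHom.id_apply]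
    by_cases ht : t = Sum.inr 0
    · subst ht
      rw [hθto0, map_mul, map_pow, hθinv0, hθinvs, mul_assoc, inv_mul_cancel, mul_one]
    · have : θto (FreeGroup.of t) = FreeGroup.of t := by simp [θto, ht]
      rw [this]
      simp [θinv, ht]
  have hθ2 : θto.comp θinv = MonoidHom.id _ := by
    ext t
    simp only [MonoidHom.comp_apply, MonoidHom.id_apply]
    by_cases ht : t = Sum.inr 0
    · subst ht
      rw [hθinv0, map_mul, map_inv, map_pow, hθto0, hθtos, mul_assoc, mul_inv_cancel, mul_one]
    · have : θinv (FreeGroup.of t) = FreeGroup.of t := by simp [θinv, ht]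
      rw [this]
      simp [θto, ht]
  let θ : FreeGroup L ≃* FreeGroup L := MonoidHom.toMulEquiv θto θinv hθ1 hθ2
  -- the automorphism `β` of `Γ_{g,r+2}` and its extension `e` to the completion
  let fe := PuncturedSurfaceGroup.freeEquiv g (r + 1)
  let β : PuncturedSurfaceGroup g (r + 2) ≃* PuncturedSurfaceGroup g (r + 2) :=
    fe.trans (θ.trans fe.symm)
  have hfeβ : ∀ γ, fe (β γ) = θto (fe γ) := fun γ => by
    change fe (fe.symm (θ (fe γ))) = _
    rw [MulEquiv.apply_symm_apply]
    rfl
  obtain ⟨e, he⟩ := hι.exists_continuousMulEquiv (hι.comp_mulEquiv β)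
  -- the continuous extension `F` of the character `f = φ ∘ fe`
  let f : PuncturedSurfaceGroup g (r + 2) →* M := φ.comp fe.toMonoidHom
  have hf : ∀ γ, f γ = φ (fe γ) := fun γ => rfl
  have hM : IsSigmaInteger Sigma (Nat.card M) := by
    have : Nat.card M = p ^ 2 * p ^ 2 := by
      change Nat.card (ZMod (p ^ 2) × ZMod (p ^ 2)) = _
      rw [Nat.card_prod, Nat.card_zmod]
    rw [this]
    exact (isSigmaInteger_prime_pow hp hpS 2).mul (isSigmaInteger_prime_pow hp hpS 2)
  obtain ⟨F, hFc, hFι⟩ := hι.exists_continuous_extend_top hM f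
  -- values of `f`
  have h1 : (1 : Fin (r + 2)) = Fin.succ 0 := rfl
  have hfβ : f (β (PuncturedSurfaceGroup.c 1)) = Multiplicative.ofAdd (1, 2) := by
    rw [hf, hfeβ, h1, PuncturedSurfaceGroup.freeEquiv_c_succ, hθto0, map_mul, map_pow, hφ, hφ, hw0, hws,
      ← ofAdd_nsmul, ← ofAdd_add]
    congr 1
    ext <;> simp
  have hfsucc : ∀ j : Fin (r + 1), f (PuncturedSurfaceGroup.c (Fin.succ j)) = w (Sum.inr j) := fun j => by
    rw [hf, PuncturedSurfaceGroup.freeEquiv_c_succ, hφ]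
  have hfzero : f (PuncturedSurfaceGroup.c 0) = Multiplicative.ofAdd (-((1 : ZMod (p ^ 2)), ε)) := by
    rw [hf, PuncturedSurfaceGroup.freeEquiv_c_zero, map_mul, map_inv, map_inv]
    have hA : φ (PuncturedSurfaceGroup.commProd g (r + 1)) = 1 := by
      simp only [PuncturedSurfaceGroup.commProd, map_list_prod, List.map_map, Function.comp_def, map_mul,
        map_inv]
      exact List.prod_eq_one fun x hx => by
        obtain ⟨i, -, rfl⟩ := List.mem_map.mp hx
        rw [mul_inv_cancel_comm, mul_inv_cancel]
    have hB : φ (PuncturedSurfaceGroup.cuspProd g (r + 1)) = Multiplicative.ofAdd (1, ε) := by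
      rw [← hsval, PuncturedSurfaceGroup.cuspProd, map_list_prod, List.map_map, ← Fin.prod_univ_def]
      refine Finset.prod_congr rfl fun j _ => ?_
      rw [Function.comp_apply, hφ]
    rw [hA, hB, inv_one, one_mul, ← ofAdd_neg]
  -- arithmetic in `(ℤ/p²)²`
  haveI : Fact (1 < p ^ 2) := ⟨Nat.one_lt_pow two_ne_zero hp.one_lt⟩
  have h2ne : (2 : ZMod (p ^ 2)) ≠ 0 := by
    intro h
    have h' : ((2 : ℕ) : ZMod (p ^ 2)) = 0 := by exact_mod_cast h
    rw [ZMod.natCast_eq_zero_iff] at h'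
    have := Nat.le_of_dvd two_pos h'
    have h4 : 4 ≤ p ^ 2 := by nlinarith [hp.two_le]
    omega
  have h12 : (1 : ZMod (p ^ 2)) ≠ 2 := fun h => by
    have : (2 : ZMod (p ^ 2)) - 1 = 0 := by rw [← h, sub_self]
    norm_num at this
  -- no cusp value generates a cyclic group containing `(1, 2)`
  have key : ∀ y : Fin (r + 2),
      Multiplicative.ofAdd ((1 : ZMod (p ^ 2)), (2 : ZMod (p ^ 2))) ∉
        Subgroup.zpowers (f (PuncturedSurfaceGroup.c y)) := by
    intro y hy
    obtain ⟨k, hk⟩ := Subgroup.mem_zpowers_iff.mp hy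
    refine Fin.cases ?_ (fun j => ?_) y hk
    · -- `y = 0`: value `−(1, ε)`
      intro hk
      rw [hfzero, ← ofAdd_zsmul] at hk
      have hk' := Multiplicative.ofAdd.injective hk
      rw [Prod.ext_iff] at hk'
      obtain ⟨hk1, hk2⟩ := hk'
      simp only [Prod.smul_fst, Prod.smul_snd, Prod.neg_mk, smul_neg] at hk1 hk2
      rcases hε with hε | hε
      · rw [hε, smul_zero, neg_zero] at hk2
        exact h2ne hk2.symm
      · rw [hε, hk1] at hk2
        exact h12 hk2
    · -- `y = j + 1`: value `w (inr j) ∈ {(1,0), (0,1), 0}`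
      intro hk
      rw [hfsucc, ← show w (Sum.inr j) = w (Sum.inr j) from rfl] at hk
      by_cases hj0 : (Sum.inr j : L) = Sum.inr 0
      · rw [hj0, hw0, ← ofAdd_zsmul] at hk
        have hk' := (Prod.ext_iff.mp (Multiplicative.ofAdd.injective hk)).2
        simp only [Prod.smul_snd, smul_zero] at hk'
        exact h2ne hk'.symm
      · by_cases hjs : (Sum.inr j : L) = s
        · have : w (Sum.inr j) = Multiplicative.ofAdd (0, 1) := by rw [hjs, hws]
          rw [this, ← ofAdd_zsmul] at hk
          have hk' := (Prod.ext_iff.mp (Multiplicative.ofAdd.injective hk)).1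
          simp only [Prod.smul_fst, smul_zero] at hk'
          exact one_ne_zero hk'.symm
        · have : w (Sum.inr j) = 1 := by simp [w, hj0, hjs]
          rw [this, one_zpow] at hk
          have hk' := (Prod.ext_iff.mp (Multiplicative.ofAdd.injective (ofAdd_zero.trans hk))).1
          simp at hk'
  -- conclusion
  refine ⟨e, fun y q heq => key y ?_⟩
  -- `ι(β c₁) ∈ ê(Ī₁) = q Ī_y q⁻¹`, then apply `F`
  have hmem : ι (β (PuncturedSurfaceGroup.c 1)) ∈
      ((PuncturedSurfaceGroup.cuspInertia (g := g) (1 : Fin (r + 2))).map ι).topologicalClosure.map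
        e.toMulEquiv.toMonoidHom := by
    refine ⟨ι (PuncturedSurfaceGroup.c 1), Subgroup.le_topologicalClosure _
      ⟨PuncturedSurfaceGroup.c 1, Subgroup.mem_zpowers _, rfl⟩, ?_⟩
    change e (ι _) = _
    rw [he]
    rfl
  rw [heq, Subgroup.mem_smul_pointwise_iff_exists] at hmem
  obtain ⟨z, hz, hzeq⟩ := hmem
  have hFz : F z ∈ Subgroup.zpowers (f (PuncturedSurfaceGroup.c y)) := by
    rw [← hFι]
    refine map_topologicalClosure_zpowers_le F hFc (ι (PuncturedSurfaceGroup.c y)) ⟨z, ?_, rfl⟩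
    rw [← MonoidHom.map_zpowers]
    exact hz
  have hFβ : F (ι (β (PuncturedSurfaceGroup.c 1))) = F z := by
    rw [← hzeq, ConjAct.smul_def, map_mul, map_mul, map_inv, mul_inv_cancel_comm]
  rw [hFι, hfβ] at hFβ
  rw [← hFβ] at hFz
  exact hFz

end Literature.AnabelianGeometry.SemiGraphs.SemiGraphOfAnabelioids.IsProSigmaCompletion

end
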